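import Literature.Computability.MetaComplexity.DepthFregeResolutionSequents
import HarnessLib

/-!
# Bounded-depth `textbookFrege` p-simulates resolution (size polynomial in length and width)

Topic `Literature/Computability/MetaComplexity`. The truth-table simulation of
`DepthFregeOfResolutionWidth.lean` pays `2^{2w}` per resolution step. Here each line is simulated
by the STRUCTURAL sequent derivations of `DepthFregeResolutionSequents.lean` (flatten, one cut on
the pivot, fold), plugged into the accumulating chain of `DepthFregeLocalChain.lean`: a resolution
refutation `π` of width `≤ w` of a CNF `φ` of width `≤ w` yields a depth-`17` `textbookFrege` proof
of `¬ ofCNF φ` of size `≤ 2^24 · (|φ| + |π| + w + 2)^6` — POLYNOMIAL in length and width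
(`exists_isDepthProofOf_of_isResRefutation_poly`): the folklore p-simulation of resolution by
bounded-depth Frege (Krajíček, *Proof complexity*, CUP 2019, §5.1/§5.4).

* `localStepOfSeqS` — the local step of the chain with the three-member sequent supplied
  (instead of the truth table of `localStepS`);
* `chain_res` — the chain over the lines of `π` (`IsLocalRefutation.carried` bookkeeping);
* `resSim_bound`, `exists_isDepthProofOf_of_isResRefutation_poly`.

[folklore]
-/

namespace Literature.Computability.MetaComplexity

open Complexity Complexity.PropForm TextbookFrege
open KrajicekRamsey (litOf dd_litOf_le dd_clauseOf_le)

namespace TextbookFrege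

variable {D B : ℕ}

/-! ### The local step with the sequent supplied -/

variable {ℓ ℓ₀ P Q : ℕ} {M : List (PropForm ℕ)} {A₁ A₂ C : PropForm ℕ}

/-- **Local step from a supplied sequent** (`localStepS` of `DepthFregeLocalChain.lean` with the
truth table replaced by a given derivation of `⊢ C, ¬A₁, ¬A₂`): `⊢ C ∧ ⋀M, ¬⋀M` with
`ℓ₀ + 252 Q + 6300` lines. [folklore] -/
theorem localStepOfSeqS (hM : ∀ X ∈ M, X.dd ≤ 3) (hP : ∀ X ∈ M, X.size ≤ P) (hQ : M.length + 1 ≤ Q)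
    (hA₁ : A₁ ∈ M) (hA₂ : A₂ ∈ M) (hC : C.dd ≤ 3) (hCP : C.size ≤ P)
    (t₀ : BD D B ℓ₀ (disjList [C, neg A₁, neg A₂]))
    (hD : 16 ≤ D) (hB : 128 * (Q * (P + 1) + 1) + 600 ≤ B) :
    BD D B (ℓ₀ + 252 * Q + 6300) (disjList [conj C (conjList M), neg (conjList M)]) := by
  have hKsize : (conjList M).size ≤ Q * (P + 1) + 1 := size_conjList_le hP (by omega)
  have hKdd : (conjList M).dd ≤ 5 := dd_conjList_le_five hM
  have hnKdd : (neg (conjList M)).dd ≤ 6 := dd_neg_conjList_le_six hM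
  have hP₁ : A₁.size ≤ P := hP A₁ hA₁
  have hP₂ : A₂.size ≤ P := hP A₂ hA₂
  have hd₁ : A₁.dd ≤ 3 := hM A₁ hA₁
  have hd₂ : A₂.dd ≤ 3 := hM A₂ hA₂
  have hnd₁ : (neg A₁).dd ≤ 5 := by rw [dd_neg]; have := altDepthAux_le_dd_succ 1 A₁; omega
  have hnd₂ : (neg A₂).dd ≤ 5 := by rw [dd_neg]; have := altDepthAux_le_dd_succ 1 A₂; omega
  have hPK : P ≤ Q * (P + 1) := by
    have : 1 ≤ Q := by omega
    calc P ≤ 1 * (P + 1) := by omega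
      _ ≤ Q * (P + 1) := Nat.mul_le_mul_right _ this
  have hlenQ : M.length ≤ Q := by omega
  have e₁ : BD D B (12 + 126 * Q) (disjList [neg (conjList M), A₁]) :=
    (conjExtractS hA₁ hM (by omega) (by omega)).mono (by nlinarith)
  have e₂ : BD D B (12 + 126 * Q) (disjList [neg (conjList M), A₂]) :=
    (conjExtractS hA₂ hM (by omega) (by omega)).mono (by nlinarith)
  have hctx : ∀ X ∈ [neg A₂, neg A₁, C, neg (conjList M)], X.dd ≤ 6 := by
    intro X hX
    simp only [List.mem_cons, List.not_mem_nil, or_false] at hX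
    rcases hX with rfl | rfl | rfl | rfl <;> omega
  have hsub₀ : ∀ X ∈ [C, neg A₁, neg A₂], X ∈ [neg A₂, neg A₁, C, neg (conjList M)] := by
    intro X hX; simp only [List.mem_cons, List.not_mem_nil, or_false] at hX ⊢; tauto
  have t₁ : BD D B (ℓ₀ + 1250) (disjList [neg A₂, neg A₁, C, neg (conjList M)]) :=
    subsetN (N := 4) t₀ hsub₀ hctx (by omega) (by
        simp only [size_disjList_cons, size_disjList_nil, size]; omega) (by simp) (by simp)
  have hsub₂ : ∀ X ∈ [neg (conjList M), A₂], X ∈ [A₂, neg A₁, C, neg (conjList M)] := by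
    intro X hX; simp only [List.mem_cons, List.not_mem_nil, or_false] at hX ⊢; tauto
  have e₂' : BD D B (12 + 126 * Q + 1250) (disjList [A₂, neg A₁, C, neg (conjList M)]) :=
    subsetN (N := 4) e₂ hsub₂ (p := 6) (by
        intro X hX; simp only [List.mem_cons, List.not_mem_nil, or_false] at hX
        rcases hX with rfl | rfl | rfl | rfl <;> omega) (by omega) (by
        simp only [size_disjList_cons, size_disjList_nil, size]; omega) (by simp) (by simp)
  have c₁ := cutS e₂' t₁ (by simp only [size_disjList_cons, size_disjList_nil, size]; omega)
  have hsub₁ : ∀ X ∈ [neg (conjList M), A₁], X ∈ [A₁, C, neg (conjList M)] := by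
    intro X hX; simp only [List.mem_cons, List.not_mem_nil, or_false] at hX ⊢; tauto
  have e₁' : BD D B (12 + 126 * Q + 1250) (disjList [A₁, C, neg (conjList M)]) :=
    subsetN (N := 4) e₁ hsub₁ (p := 6) (by
        intro X hX; simp only [List.mem_cons, List.not_mem_nil, or_false] at hX
        rcases hX with rfl | rfl | rfl <;> omega) (by omega) (by
        simp only [size_disjList_cons, size_disjList_nil, size]; omega) (by simp) (by simp)
  have c₂ := cutS e₁' c₁ (by simp only [size_disjList_cons, size_disjList_nil, size]; omega)
  have ax₀ : BD D B 12 (disjList [neg (conjList M), conjList M]) := axS (conjList M) (by omega) (by omega)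
  have hsubax : ∀ X ∈ [neg (conjList M), conjList M], X ∈ [conjList M, neg (conjList M)] := by
    intro X hX; simp only [List.mem_cons, List.not_mem_nil, or_false] at hX ⊢; tauto
  have ax : BD D B (12 + 450) (disjList [conjList M, neg (conjList M)]) :=
    subsetN (N := 2) ax₀ hsubax (p := 6) (by
        intro X hX; simp only [List.mem_cons, List.not_mem_nil, or_false] at hX
        rcases hX with rfl | rfl <;> omega) (by omega) (by
        simp only [size_disjList_cons, size_disjList_nil, size]; omega) (by simp) (by simp)
  have fin := consConjS c₂ ax (by omega) (by omega) (by
      simp only [disjList_cons, disjList_nil, dd_disj, dd_const]; omega) (by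
      simp only [size_disjList_cons, size_disjList_nil, size]; omega)
  refine fin.mono ?_
  omega

/-! ### The chain over a resolution refutation -/

/-- The line cost of one simulated resolution line. [folklore] -/
def resStepCost (w Q : ℕ) : ℕ := seqCost w (w + 6) + 252 * Q + 8000

/-- Line bookkeeping of one chain step. [folklore] -/
theorem resStep_le (k w Q : ℕ) :
    462 + k * resStepCost w Q + (seqCost w (w + 6) + 252 * Q + 6300) + 1700 ≤
      462 + (k + 1) * resStepCost w Q := by
  have e : (k + 1) * resStepCost w Q = k * resStepCost w Q + resStepCost w Q := by ring
  rw [e]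
  have e2 : resStepCost w Q = seqCost w (w + 6) + 252 * Q + 8000 := rfl
  omega

/-- **The chain.** After the first `k` lines of `π`: `⊢ ⋀(carried k), ¬⋀φ` with
`462 + k · resStepCost` lines, where the carried conjunction consists of the clause formulas of
the first `k` lines (most recent first) and of `φ`. [folklore] -/
theorem chain_res {φ : CNF ℕ} {π : List (ResLine ℕ)} (hπ : IsResRefutation φ π) {w : ℕ}
    (hw : resWidth π ≤ w) (hφ : ∀ c ∈ φ, c.length ≤ w) {B : ℕ}
    (hB : 128 * ((φ.length + π.length + 1) * (3 * w + 1 + 1) + 1) + 200 * (w + 1) + 600 ≤ B) :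
    ∀ k, k ≤ π.length →
      BD 16 B (462 + k * resStepCost w (φ.length + π.length + 1))
        (disjList [conjList (IsLocalRefutation.carried φ (π.map fun l => l.clause.toList) k),
          neg (conjList (φ.map KrajicekRamsey.clauseOf))]) := by
  classical
  set cs : List (Clause ℕ) := π.map fun l => l.clause.toList with hcs
  set P := 3 * w + 1 with hP
  set Q := φ.length + π.length + 1 with hQ
  set M₀ := φ.map KrajicekRamsey.clauseOf with hM₀
  have hwl : ∀ l ∈ π, l.clause.card ≤ w := resWidth_le_iff.1 hw
  have hcslen : cs.length = π.length := by rw [hcs, List.length_map]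
  have hcsw : ∀ C ∈ cs, C.length ≤ w := by
    intro C hC
    obtain ⟨l, hl, rfl⟩ := List.mem_map.1 hC
    rw [Finset.length_toList]; exact hwl l hl
  have hddM : ∀ k, ∀ X ∈ IsLocalRefutation.carried φ cs k, X.dd ≤ 3 := fun k X hX => by
    obtain ⟨C, -, rfl⟩ := IsLocalRefutation.mem_carried hX
    exact (dd_clauseOf_le C).trans (by norm_num)
  have hPM : ∀ k, ∀ X ∈ IsLocalRefutation.carried φ cs k, X.size ≤ P := fun k X hX => by
    obtain ⟨C, hC, rfl⟩ := IsLocalRefutation.mem_carried hX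
    rcases hC with hC | hC
    · exact IsLocalRefutation.size_clauseOf_le_P (hφ C hC)
    · exact IsLocalRefutation.size_clauseOf_le_P (hcsw C (List.mem_of_mem_take hC))
  have e0 : IsLocalRefutation.carried φ cs 0 = M₀ := by simp [IsLocalRefutation.carried, hM₀]
  have hM₀dd : (conjList M₀).dd ≤ 5 := dd_conjList_le_five fun X hX => hddM 0 X (e0 ▸ hX)
  have hΦdd : (neg (conjList M₀)).dd ≤ 6 := dd_neg_conjList_le_six fun X hX => hddM 0 X (e0 ▸ hX)
  have hM₀size : (conjList M₀).size ≤ Q * (P + 1) + 1 :=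
    size_conjList_le (fun X hX => hPM 0 X (e0 ▸ hX)) (by rw [hM₀, List.length_map]; omega)
  have hΦB : 8 * (neg (conjList M₀)).size ≤ B := by
    simp only [size]; have hQ1 : 1 ≤ Q := by omega
    nlinarith
  intro k
  induction k with
  | zero =>
    intro _
    have ax : BD 16 B 12 (disjList [neg (conjList M₀), conjList M₀]) :=
      axS (conjList M₀) (by omega) (by nlinarith)
    rw [e0, Nat.zero_mul, Nat.add_zero]
    have hsub : ∀ X ∈ [neg (conjList M₀), conjList M₀], X ∈ [conjList M₀, neg (conjList M₀)] := by
      intro X hX; simp only [List.mem_cons, List.not_mem_nil, or_false] at hX ⊢; tauto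
    refine (subsetN (N := 2) ax hsub (p := 6) ?_ (by norm_num) ?_ (by simp) (by simp)).mono (by norm_num)
    · intro X hX
      simp only [List.mem_cons, List.not_mem_nil, or_false] at hX
      rcases hX with rfl | rfl
      · exact hM₀dd.trans (by norm_num)
      · exact hΦdd
    · simp only [size_disjList_cons, size_disjList_nil, size]; nlinarith
  | succ k ih =>
    intro hk
    have hk' : k < π.length := Nat.lt_of_succ_le hk
    have hkcs : k < cs.length := by rw [hcslen]; exact hk'
    have J := ih hk'.le
    rw [IsLocalRefutation.carried_succ hkcs]
    have hcsk : cs[k]'hkcs = (π[k]'hk').clause.toList := by simp [hcs]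
    have hC : (KrajicekRamsey.clauseOf (cs[k]'hkcs)).dd ≤ 3 := (dd_clauseOf_le _).trans (by norm_num)
    have hCP : (KrajicekRamsey.clauseOf (cs[k]'hkcs)).size ≤ P :=
      IsLocalRefutation.size_clauseOf_le_P (hcsw _ (List.getElem_mem hkcs))
    have hQk : (IsLocalRefutation.carried φ cs k).length + 1 ≤ Q := by
      have := IsLocalRefutation.length_carried_le (φ := φ) (cs := cs) k; rw [hcslen] at this; omega
    have hBstep : 128 * (Q * (P + 1) + 1) + 600 ≤ B := by omega
    have hBchain : 128 * (Q * (P + 1) + 1) + 40 * 0 + 600 ≤ B := by omega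
    -- the earlier clause formulas are carried
    have hmem_prev : ∀ {i : ℕ} (hi : i < k) (hiπ : i < π.length),
        KF ((π[i]'hiπ).clause) ∈ IsLocalRefutation.carried φ cs k := by
      intro i hi hiπ
      have hics : i < cs.length := by rw [hcslen]; exact hiπ
      have e : KF ((π[i]'hiπ).clause) = KrajicekRamsey.clauseOf (cs[i]'hics) := by simp [KF, hcs]
      rw [e]
      exact IsLocalRefutation.clauseOf_mem_carried (Or.inr (getElem_mem_take hi hics))
    -- the three-member sequent of the current line
    have hv := hπ.1 k hk'
    have t₀ : ∃ A₁ A₂, A₁ ∈ IsLocalRefutation.carried φ cs k ∧ A₂ ∈ IsLocalRefutation.carried φ cs k ∧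
          BD 16 B (seqCost w (w + 6)) (disjList [KrajicekRamsey.clauseOf (cs[k]'hkcs), neg A₁, neg A₂]) := by
      unfold IsValidResLine at hv
      split at hv
      · -- initial
        obtain ⟨c, hc, hck⟩ := List.mem_map.1 hv
        refine ⟨_, _, IsLocalRefutation.clauseOf_mem_carried (Or.inl hc),
          IsLocalRefutation.clauseOf_mem_carried (Or.inl hc), ?_⟩
        have t := initialSeqS (D := 16) (B := B) c (hφ c hc) (by norm_num) (N := w + 6) le_rfl (by omega)
        have e : KF c.toFinset = KrajicekRamsey.clauseOf (cs[k]'hkcs) := by rw [hcsk, ← hck]; rfl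
        rw [e] at t; exact t
      · -- resolvent
        rename_i i j v _
        obtain ⟨hi, hj, hres⟩ := hv
        have hi' : i < k ∧ i < π.length := by simpa [List.length_take] using hi
        have hj' : j < k ∧ j < π.length := by simpa [List.length_take] using hj
        rw [List.getElem_take, List.getElem_take] at hres
        refine ⟨_, _, hmem_prev hi'.1 hi'.2, hmem_prev hj'.1 hj'.2, ?_⟩
        have t := resolventSeqS (D := 16) (B := B) hres (hwl _ (List.getElem_mem hi'.2))
          (hwl _ (List.getElem_mem hj'.2)) (hwl _ (List.getElem_mem hk')) (by norm_num) (N := w + 6) le_rfl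
          (by omega)
        have e : KF ((π[k]'hk').clause) = KrajicekRamsey.clauseOf (cs[k]'hkcs) := by rw [hcsk]; rfl
        rw [e] at t; exact t
      · -- weakening
        rename_i i _
        obtain ⟨hi, hsubset⟩ := hv
        have hi' : i < k ∧ i < π.length := by simpa [List.length_take] using hi
        rw [List.getElem_take] at hsubset
        refine ⟨_, _, hmem_prev hi'.1 hi'.2, hmem_prev hi'.1 hi'.2, ?_⟩
        have t := weakenSeqS (D := 16) (B := B) hsubset (hwl _ (List.getElem_mem hi'.2))
          (hwl _ (List.getElem_mem hk')) (by norm_num) (N := w + 6) le_rfl (by omega)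
        have e : KF ((π[k]'hk').clause) = KrajicekRamsey.clauseOf (cs[k]'hkcs) := by rw [hcsk]; rfl
        rw [e] at t; exact t
    have hle := resStep_le k w Q
    obtain ⟨A₁, A₂, hA₁, hA₂, t₀⟩ := t₀
    have step := localStepOfSeqS (hddM k) (hPM k) hQk hA₁ hA₂ hC hCP t₀ (by norm_num) hBstep
    have nxt := chainStepS (D := 16) (N := 0) (hddM k) (hPM k) hQk hC hCP hΦdd hΦB J step (by norm_num) hBchain
    exact nxt.mono hle

end TextbookFrege

/-- The size bookkeeping of the simulation: lines times line size is `≤ 2^24 (L + R + w + 2)^6`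
(`L = |φ|`, `R = |π|`). [folklore] -/
theorem TextbookFrege.resSim_bound (L R w : ℕ) :
    (462 + R * TextbookFrege.resStepCost w (L + R + 1) + 126 * (L + R + 1) + 3000) *
        (128 * ((L + R + 1) * (3 * w + 1 + 1) + 1) + 200 * (w + 1) + 600) ≤
      2 ^ 24 * (L + R + w + 2) ^ 6 := by
  set X := L + R + w + 2 with hX
  set Q := L + R + 1 with hQ
  have hX2 : 2 ≤ X := by omega
  have hXQ : Q ≤ X := by omega
  have hX3 : 8 ≤ X ^ 3 := by
    calc 8 = 2 ^ 3 := by norm_num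
      _ ≤ X ^ 3 := Nat.pow_le_pow_left hX2 3
  have hXX : X ≤ X ^ 3 := by
    calc X = X ^ 1 := (pow_one X).symm
      _ ≤ X ^ 3 := Nat.pow_le_pow_right (by omega) (by norm_num)
  have hseq : TextbookFrege.seqCost w (w + 6) ≤ 2 ^ 12 * X ^ 3 := by
    unfold TextbookFrege.seqCost
    have h1 : w + 2 ≤ X := by omega
    have h2 : (w + 6 + 1) ^ 2 ≤ 13 * X ^ 2 := by nlinarith
    have h3 : 200 * (w + 6 + 1) ^ 2 + 20 ≤ 2620 * X ^ 2 := by nlinarith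
    calc (w + 2) * (200 * (w + 6 + 1) ^ 2 + 20) ≤ X * (2620 * X ^ 2) := Nat.mul_le_mul h1 h3
      _ = 2620 * X ^ 3 := by ring
      _ ≤ 2 ^ 12 * X ^ 3 := Nat.mul_le_mul_right _ (by norm_num)
  set S3 := X ^ 3 with hS3
  have hstep : TextbookFrege.resStepCost w Q ≤ 8192 * S3 := by
    unfold TextbookFrege.resStepCost
    have h1 : 252 * Q ≤ 252 * S3 := (Nat.mul_le_mul_left _ hXQ).trans (Nat.mul_le_mul_left _ hXX)
    have h2 : TextbookFrege.seqCost w (w + 6) ≤ 4096 * S3 := by simpa using hseq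
    omega
  set T := TextbookFrege.resStepCost w Q with hT
  have hlines : 462 + R * T + 126 * Q + 3000 ≤ 16384 * (X * S3) := by
    have h1 : R * T ≤ X * (8192 * S3) := Nat.mul_le_mul (by omega) hstep
    have h2 : 126 * Q ≤ 126 * S3 := (Nat.mul_le_mul_left _ hXQ).trans (Nat.mul_le_mul_left _ hXX)
    have h3 : S3 ≤ X * S3 := Nat.le_mul_of_pos_left _ (by omega)
    nlinarith
  have hbud : 128 * (Q * (3 * w + 1 + 1) + 1) + 200 * (w + 1) + 600 ≤ 1024 * X ^ 2 := by
    have h1 : Q * (3 * w + 1 + 1) ≤ X * (3 * X) := Nat.mul_le_mul hXQ (by omega)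
    nlinarith
  calc (462 + R * T + 126 * Q + 3000) * (128 * (Q * (3 * w + 1 + 1) + 1) + 200 * (w + 1) + 600)
      ≤ (16384 * (X * S3)) * (1024 * X ^ 2) := Nat.mul_le_mul hlines hbud
    _ = 2 ^ 24 * X ^ 6 := by rw [hS3]; ring

/-- **Bounded-depth Frege p-simulates resolution.** A resolution refutation `π` of width `≤ w`
of a CNF `φ` all of whose clauses have `≤ w` literals yields a depth-`17` `textbookFrege` proof of
`¬ ofCNF φ` of size at most `2^24 · (|φ| + |π| + w + 2)^6` — polynomial in the length and the
width, with NO exponential dependence on `w` (compare `exists_isDepthProofOf_of_isResRefutation`).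
[cite: KrajicekProofComplexity2019, §5.1/§5.4 (resolution and its width; Frege simulates R)] -/
theorem exists_isDepthProofOf_of_isResRefutation_poly {φ : CNF ℕ} {π : List (ResLine ℕ)}
    (hπ : IsResRefutation φ π) {w : ℕ} (hw : resWidth π ≤ w) (hφ : ∀ c ∈ φ, c.length ≤ w) :
    ∃ π', textbookFrege.IsDepthProofOf 17 π' (neg (ofCNF φ)) ∧
      proofSize π' ≤ 2 ^ 24 * (φ.length + π.length + w + 2) ^ 6 := by
  classical
  set Q := φ.length + π.length + 1 with hQ
  set P := 3 * w + 1 with hP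
  set Bud := 128 * (Q * (P + 1) + 1) + 200 * (w + 1) + 600 with hBud
  set cs : List (Clause ℕ) := π.map fun l => l.clause.toList with hcs
  have hwl : ∀ l ∈ π, l.clause.card ≤ w := resWidth_le_iff.1 hw
  have hcslen : cs.length = π.length := by rw [hcs, List.length_map]
  have J := TextbookFrege.chain_res hπ hw hφ (B := Bud) (by rw [hBud, hQ, hP]) π.length le_rfl
  -- the end of the chain
  have hcsw : ∀ C ∈ cs, C.length ≤ w := by
    intro C hC; obtain ⟨l, hl, rfl⟩ := List.mem_map.1 hC; rw [Finset.length_toList]; exact hwl l hl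
  have hddM : ∀ X ∈ IsLocalRefutation.carried φ cs π.length, X.dd ≤ 3 := fun X hX => by
    obtain ⟨C, -, rfl⟩ := IsLocalRefutation.mem_carried hX
    exact (KrajicekRamsey.dd_clauseOf_le C).trans (by norm_num)
  have hPM : ∀ X ∈ IsLocalRefutation.carried φ cs π.length, X.size ≤ P := fun X hX => by
    obtain ⟨C, hC, rfl⟩ := IsLocalRefutation.mem_carried hX
    rcases hC with hC | hC
    · exact IsLocalRefutation.size_clauseOf_le_P (hφ C hC)
    · exact IsLocalRefutation.size_clauseOf_le_P (hcsw C (List.mem_of_mem_take hC))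
  have hbot : const false ∈ IsLocalRefutation.carried φ cs π.length := by
    have e : KrajicekRamsey.clauseOf ([] : Clause ℕ) = const false := rfl
    rw [← e]
    refine IsLocalRefutation.clauseOf_mem_carried (Or.inr ?_)
    rw [← hcslen, List.take_length]
    obtain ⟨l, hl, hl0⟩ := hπ.2
    exact List.mem_map.2 ⟨l, hl, by rw [hl0, Finset.toList_empty]⟩
  have e0 : IsLocalRefutation.carried φ cs 0 = φ.map KrajicekRamsey.clauseOf := by
    simp [IsLocalRefutation.carried]
  have hΦdd : (neg (conjList (φ.map KrajicekRamsey.clauseOf))).dd ≤ 6 :=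
    TextbookFrege.dd_neg_conjList_le_six fun X hX => by
      rw [← e0] at hX
      obtain ⟨C, -, rfl⟩ := IsLocalRefutation.mem_carried hX
      exact (KrajicekRamsey.dd_clauseOf_le C).trans (by norm_num)
  have hM₀size : (conjList (φ.map KrajicekRamsey.clauseOf)).size ≤ Q * (P + 1) + 1 :=
    TextbookFrege.size_conjList_le (M := φ.map KrajicekRamsey.clauseOf) (fun X hX => by
      rw [← e0] at hX
      obtain ⟨C, hC, rfl⟩ := IsLocalRefutation.mem_carried hX
      rcases hC with hC | hC
      · exact IsLocalRefutation.size_clauseOf_le_P (hφ C hC)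
      · simp at hC) (by rw [List.length_map]; omega)
  have hΦB : 8 * (neg (conjList (φ.map KrajicekRamsey.clauseOf))).size ≤ Bud := by
    simp only [size]; have hQ1 : 1 ≤ Q := by omega
    nlinarith
  have hlen := IsLocalRefutation.length_carried_le (φ := φ) (cs := cs) π.length
  rw [hcslen] at hlen
  have fin := TextbookFrege.chainFinalS (D := 16) (P := P) (Q := Q) hddM hPM (by omega) hbot hΦdd hΦB J
    (by norm_num) (by omega)
  rw [← KrajicekRamsey.ofCNF_eq_conjList] at fin
  obtain ⟨π', hπ', hsize⟩ := fin.exists_isDepthProofOf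
  refine ⟨π', hπ', hsize.trans ?_⟩
  have hb := TextbookFrege.resSim_bound φ.length π.length w
  rw [hBud, hQ, hP]
  exact hb



end Literature.Computability.MetaComplexity
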